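import Summits.CriticalPhenomena.SAWScalingLimit.Theorems.SAWDevelopingMapObservableToSLETypeLadderCarvedReductionSqueezeHexagons
import Summits.CriticalPhenomena.SAWScalingLimit.Theorems.SAWDefectDecoherenceObservableToSLERGateTransferHexagonBounds
import Literature.Probability.Percolation.SmirnovSeparatingData
import Literature.Probability.LatticeModels.TriangularLatticeProofs
import HarnessLib

/-!
# Limits of the pinned level hexagons along a subsequence (piece (T-A lim-a) of stub T-A
# `stub_carvedReduction_squeezeGeometry`)

Crux `SAWDevelopingMap.ObservableToSLE` (stmt-CriticalPhenomena-10472), line `six-class-type-ladder`,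
stub T-A `stub_carvedReduction_squeezeGeometry`.  Landing target:
`Summits/CriticalPhenomena/SAWScalingLimit/Theorems/SAWDevelopingMapObservableToSLETypeLadderCarvedReductionSqueezeLevelLimits.lean`
(`--supports stmt-CriticalPhenomena-10472`).  Sequel of `…SqueezeHexagons` (p133791).

THE LIMIT STRUCTURE OF THE REMOVED SETS, first half (memo item 2 of the T-A plan): one tame level
`L_j` per index (a union of at most `N` lattice hexagons `hexBall t r`, `R`-local about its root),
read in the PINNED FRAME `z ↦ s_j z - τ_j` (`s_j → 0⁺`, pinned roots converging).  The pinned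
continuum carrier of `hexBall t r` is, up to `s_j/6` in every skew direction, the REGULAR skew
hexagon `Hex(C, ϱ) = {z | ∀ ℓ, |skewCoord ℓ (z - C)| ≤ ϱ}` about the pinned centre `C = s_j c_t - τ_j`
of radius `ϱ = s_j (r + 1/2)` (`pinned_mem_contHex_of_abs_le`, `abs_le_of_pinned_mem_contHex`);
centres and radii are bounded (`R`-locality), so along a subsequence (Bolzano–Weierstrass in
`(Fin N → ℂ) × (Fin N → ℝ)`, after padding the lists to length `N` with the trivial hexagon
`hexBall root 0 = {root}`) they converge, and then (`level_limits`):
* PERSISTENCE at vertex level — eventually every vertex whose pinned centre lies in the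
  `ε`-shrunken limit hexagon `Hex(C i, ϱ i - ε)` belongs to the `i`-th moving hexagon, hence to the
  level (the shrunken limit hexagons are persistently removed);
* CONTAINMENT — eventually every vertex of the level has its pinned centre in some thickened limit
  hexagon `Hex(C i, ϱ i + ε)`;
* EVENTUAL CARVING OF COMPACTS — a compact set missing the limit hexagons eventually carries no
  vertex of the level.
Registered carrier: `stub_carvedReduction_mem_hexBall_zero_iff`.
-/

noncomputable section

open scoped Topology
open Filter Set Metric
open Literature.Probability.LatticeModels (HexVertex hexGraph hexCenter triZeta triEmbed Site triEmbed_add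
  normSq_triZeta)
open Literature.Probability.RandomPlanarGeometry
open Literature.Probability.Percolation (norm_triZeta)

namespace Summit.CriticalPhenomena.SAWScalingLimit.Theorems.ObservableToSLE.TypeLadder

open Summit.CriticalPhenomena.SAWScalingLimit.Theorems.ObservableToSLER.BridgeGate

/-! ### Lattice hexagons: the centre, the trivial hexagon, a far vertex -/

/-- The trivial hexagon is the centre. -/
theorem mem_hexBall_zero_iff (t v : HexVertex) : v ∈ hexBall t 0 ↔ v = t := by
  constructor
  · intro h
    have h0 := h 0; have h1 := h 1; have h2 := h 2
    simp only [rowCoord, Fin.isValue, ↓reduceIte, one_ne_zero, Fin.reduceEq, Nat.cast_zero, abs_nonpos_iff,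
      sub_eq_zero] at h0 h1 h2
    obtain ⟨x, k⟩ := v; obtain ⟨y, k'⟩ := t
    simp only at h0 h1 h2 ⊢
    have hx : x = y := by
      ext i; fin_cases i
      · exact h1
      · exact h0
    subst hx
    have hk : (k : ℕ) = (k' : ℕ) := by exact_mod_cast (show ((k : ℕ) : ℤ) = (k' : ℕ) by linarith)
    rw [Prod.mk.injEq]
    exact ⟨rfl, Fin.ext hk⟩
  · rintro rfl; exact mem_hexBall_self _ 0

/-- **Registered sub-goal `stub_carvedReduction_mem_hexBall_zero_iff`** (crux item
stmt-CriticalPhenomena-10472, stub T-A `stub_carvedReduction_squeezeGeometry`, piece (T-A lim-a)): the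
trivial lattice hexagon is its centre. -/
theorem stub_carvedReduction_mem_hexBall_zero_iff : ∀ (t v : HexVertex), v ∈ hexBall t 0 ↔ v = t :=
  mem_hexBall_zero_iff

/-- The vertex `r` cells away from the centre in the `ζ`-direction belongs to the hexagon, and its
centre is `c_t + r ζ`. -/
theorem shift_mem_hexBall (t : HexVertex) (r : ℕ) :
    ((t.1 + Pi.single 1 (r : ℤ), t.2) : HexVertex) ∈ hexBall t r ∧
      hexCenter ((t.1 + Pi.single 1 (r : ℤ), t.2) : HexVertex) = hexCenter t + (r : ℂ) * triZeta := by
  constructor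
  · intro i
    fin_cases i <;> simp [rowCoord]
  · obtain ⟨x, k⟩ := t
    simp only [hexCenter, triEmbed_add]
    have : triEmbed (Pi.single 1 (r : ℤ)) = (r : ℂ) * triZeta := by
      simp [triEmbed]
    rw [this]; ring

/-! ### The pinned continuum hexagon versus the regular skew hexagon about the pinned centre -/

/-- **Inner half**: a point whose skew distances to the pinned centre `C = s c_t - τ` are all
`≤ s (r + 1/2) - s/6` lies, un-pinned, in `contHex s t r`. -/
theorem pinned_mem_contHex_of_abs_le {s : ℝ} (hs : 0 < s) (t : HexVertex) (r : ℕ) (τ z : ℂ)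
    (h : ∀ ℓ : Fin 3, |skewCoord ℓ (z - ((s : ℂ) * hexCenter t - τ))| ≤ s * (r + 1 / 2) - s / 6) :
    z + τ ∈ contHex s t r := by
  rw [contHex_eq_skewHex hs]
  intro ℓ
  have h1 := h ℓ
  rw [abs_le, skewCoord_sub, skewCoord_sub, skewCoord_real_mul] at h1
  have h2 := rowCoord_add_third_le_skewCoord ℓ t
  have h3 := skewCoord_le_rowCoord_add_two_thirds ℓ t
  rw [skewCoord_add]
  have h4 : s * ((rowCoord ℓ t : ℝ) + 1 / 3) ≤ s * skewCoord ℓ (hexCenter t) := mul_le_mul_of_nonneg_left h2 hs.le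
  have h5 : s * skewCoord ℓ (hexCenter t) ≤ s * ((rowCoord ℓ t : ℝ) + 2 / 3) := mul_le_mul_of_nonneg_left h3 hs.le
  constructor <;> nlinarith

/-- **Outer half**: a point lying, un-pinned, in `contHex s t r` has all skew distances to the
pinned centre `≤ s (r + 1/2) + s/6`. -/
theorem abs_le_of_pinned_mem_contHex {s : ℝ} (hs : 0 < s) (t : HexVertex) (r : ℕ) (τ z : ℂ)
    (h : z + τ ∈ contHex s t r) :
    ∀ ℓ : Fin 3, |skewCoord ℓ (z - ((s : ℂ) * hexCenter t - τ))| ≤ s * (r + 1 / 2) + s / 6 := by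
  rw [contHex_eq_skewHex hs] at h
  intro ℓ
  obtain ⟨h1, h1'⟩ := h ℓ
  rw [skewCoord_add] at h1 h1'
  have h2 := rowCoord_add_third_le_skewCoord ℓ t
  have h3 := skewCoord_le_rowCoord_add_two_thirds ℓ t
  have h4 : s * ((rowCoord ℓ t : ℝ) + 1 / 3) ≤ s * skewCoord ℓ (hexCenter t) := mul_le_mul_of_nonneg_left h2 hs.le
  have h5 : s * skewCoord ℓ (hexCenter t) ≤ s * ((rowCoord ℓ t : ℝ) + 2 / 3) := mul_le_mul_of_nonneg_left h3 hs.le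
  rw [abs_le, skewCoord_sub, skewCoord_sub, skewCoord_real_mul]
  constructor <;> nlinarith

/-- The regular skew hexagon `Hex(C, ϱ)` in slab form. -/
theorem skewHexAbs_eq (C : ℂ) (ϱ : ℝ) :
    {z : ℂ | ∀ ℓ : Fin 3, |skewCoord ℓ (z - C)| ≤ ϱ} =
      {z : ℂ | ∀ ℓ : Fin 3, (skewCoord ℓ C - ϱ) ≤ skewCoord ℓ z ∧ skewCoord ℓ z ≤ (skewCoord ℓ C + ϱ)} := by
  ext z
  simp only [mem_setOf_eq]
  refine forall_congr' fun ℓ => ?_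
  rw [skewCoord_sub, abs_le]
  constructor <;> rintro ⟨h1, h2⟩ <;> constructor <;> linarith

/-- Moving the centre of a regular skew hexagon moves the skew distances by at most twice the displacement. -/
theorem abs_skewCoord_sub_le_of_dist (ℓ : Fin 3) (z C C' : ℂ) :
    |skewCoord ℓ (z - C')| ≤ |skewCoord ℓ (z - C)| + 2 * dist C C' := by
  have h : skewCoord ℓ (z - C') = skewCoord ℓ (z - C) + skewCoord ℓ (C - C') := by
    rw [← skewCoord_add]; congr 1; ring
  rw [h]
  refine (abs_add_le _ _).trans (add_le_add le_rfl ?_)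
  rw [dist_eq_norm]
  exact abs_skewCoord_le ℓ (C - C')

/-! ### The limits -/

/-- **LIMITS OF THE PINNED LEVEL HEXAGONS**; see the module docstring.  `L j` a union of at most `N`
lattice hexagons containing `root j`, `R`-local about it at mesh `s j > 0`, `s j → 0`, pinned roots
`s_j c_{root j} - τ j → ℓ₀`.  Along a subsequence `ψ` the level `L (ψ j)` is EXACTLY the union of `N`
hexagons `hexBall (f j i).1 (f j i).2` whose pinned centres converge to `C i` and pinned radii
`s (r + 1/2)` to `ϱ i ≥ 0`, with persistence, containment and eventual carving of compacts. -/
theorem level_limits {N : ℕ} {s : ℕ → ℝ} {τ : ℕ → ℂ} {L : ℕ → Set HexVertex} {root : ℕ → HexVertex}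
    {R : ℝ} {ℓ₀ : ℂ} (hspos : ∀ j, 0 < s j) (hs0 : Tendsto s atTop (𝓝 0))
    (hlist : ∀ j, ∃ Lst : List (HexVertex × ℕ), Lst.length ≤ N ∧
      ∀ v : HexVertex, v ∈ L j ↔ ∃ tk ∈ Lst, v ∈ hexBall tk.1 tk.2)
    (hloc : ∀ j, ∀ v ∈ L j, dist ((s j : ℂ) * hexCenter v) ((s j : ℂ) * hexCenter (root j)) ≤ R)
    (hroot : ∀ j, root j ∈ L j)
    (hrootlim : Tendsto (fun j => (s j : ℂ) * hexCenter (root j) - τ j) atTop (𝓝 ℓ₀)) :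
    ∃ (ψ : ℕ → ℕ) (f : ℕ → Fin N → HexVertex × ℕ) (C : Fin N → ℂ) (ϱ : Fin N → ℝ),
      StrictMono ψ ∧ (∀ i, 0 ≤ ϱ i) ∧ (∀ i, dist (C i) ℓ₀ ≤ R) ∧
      (∀ j (v : HexVertex), v ∈ L (ψ j) ↔ ∃ i, v ∈ hexBall (f j i).1 (f j i).2) ∧
      (∀ i, Tendsto (fun j => (s (ψ j) : ℂ) * hexCenter (f j i).1 - τ (ψ j)) atTop (𝓝 (C i))) ∧
      (∀ i, Tendsto (fun j => s (ψ j) * ((f j i).2 + 1 / 2)) atTop (𝓝 (ϱ i))) ∧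
      (∀ ε > (0 : ℝ), ∀ᶠ j in atTop, ∀ (i : Fin N) (v : HexVertex),
        (∀ ℓ : Fin 3, |skewCoord ℓ ((s (ψ j) : ℂ) * hexCenter v - τ (ψ j) - C i)| ≤ ϱ i - ε) →
          v ∈ hexBall (f j i).1 (f j i).2) ∧
      (∀ ε > (0 : ℝ), ∀ᶠ j in atTop, ∀ (i : Fin N), ∀ v ∈ hexBall (f j i).1 (f j i).2,
        ∀ ℓ : Fin 3, |skewCoord ℓ ((s (ψ j) : ℂ) * hexCenter v - τ (ψ j) - C i)| ≤ ϱ i + ε) ∧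
      (∀ K : Set ℂ, IsCompact K → (∀ i, Disjoint K {z : ℂ | ∀ ℓ : Fin 3, |skewCoord ℓ (z - C i)| ≤ ϱ i}) →
        ∀ᶠ j in atTop, ∀ v ∈ L (ψ j), (s (ψ j) : ℂ) * hexCenter v - τ (ψ j) ∉ K) := by
  classical
  -- the padded cells
  choose Lst hlen hLst using hlist
  set g : ℕ → Fin N → HexVertex × ℕ := fun j i => (Lst j).getD i (root j, 0) with hg
  have hgmem : ∀ j i, g j i ∈ Lst j ∨ g j i = (root j, 0) := by
    intro j i
    by_cases h : (i : ℕ) < (Lst j).length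
    · left; rw [hg]; simp only; rw [List.getD_eq_getElem _ _ h]; exact List.getElem_mem h
    · right; rw [hg]; simp only; rw [List.getD_eq_default _ _ (not_lt.1 h)]
  have hgsub : ∀ j i, hexBall (g j i).1 (g j i).2 ⊆ L j := by
    intro j i v hv
    rcases hgmem j i with h | h
    · exact (hLst j v).2 ⟨_, h, hv⟩
    · rw [h] at hv
      rw [(mem_hexBall_zero_iff _ _).1 hv]; exact hroot j
  have hgL : ∀ j (v : HexVertex), v ∈ L j ↔ ∃ i, v ∈ hexBall (g j i).1 (g j i).2 := by
    intro j v
    constructor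
    · intro hv
      obtain ⟨tk, htk, hvtk⟩ := (hLst j v).1 hv
      obtain ⟨m, hm, rfl⟩ := List.getElem_of_mem htk
      refine ⟨⟨m, lt_of_lt_of_le hm (hlen j)⟩, ?_⟩
      rw [hg]; simp only; rw [List.getD_eq_getElem _ _ hm]; exact hvtk
    · rintro ⟨i, hi⟩; exact hgsub j i hi
  -- pinned centres and radii
  set Ck : ℕ → Fin N → ℂ := fun j i => (s j : ℂ) * hexCenter (g j i).1 - τ j with hCk
  set ϱk : ℕ → Fin N → ℝ := fun j i => s j * ((g j i).2 + 1 / 2) with hϱk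
  -- bounds
  have hCbd : ∀ j i, dist (Ck j i) ((s j : ℂ) * hexCenter (root j) - τ j) ≤ R := by
    intro j i
    rw [hCk]; simp only; rw [dist_sub_right]
    exact hloc j _ (hgsub j i (mem_hexBall_self _ _))
  have hϱbd : ∀ j i, 0 ≤ ϱk j i ∧ ϱk j i ≤ 2 * R + s j := by
    intro j i
    refine ⟨mul_nonneg (hspos j).le (by positivity), ?_⟩
    obtain ⟨hmem, hctr⟩ := shift_mem_hexBall (g j i).1 (g j i).2
    have h1 := hloc j _ (hgsub j i hmem)
    have h2 := hloc j _ (hgsub j i (mem_hexBall_self _ _))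
    have h3 : dist ((s j : ℂ) * hexCenter (((g j i).1.1 + Pi.single 1 ((g j i).2 : ℤ), (g j i).1.2) : HexVertex))
        ((s j : ℂ) * hexCenter (g j i).1) = s j * (g j i).2 := by
      rw [hctr, dist_eq_norm, mul_add, add_sub_cancel_left, norm_mul, norm_mul, Complex.norm_real,
        Complex.norm_natCast, norm_triZeta, mul_one, Real.norm_of_nonneg (hspos j).le]
    have h4 := dist_triangle ((s j : ℂ) * hexCenter (((g j i).1.1 + Pi.single 1 ((g j i).2 : ℤ), (g j i).1.2) : HexVertex))
      ((s j : ℂ) * hexCenter (root j)) ((s j : ℂ) * hexCenter (g j i).1)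
    rw [dist_comm ((s j : ℂ) * hexCenter (root j))] at h4
    rw [hϱk]; simp only
    nlinarith [hspos j]
  -- the root sequence and the meshes are bounded eventually
  have hrootbd : ∀ᶠ j in atTop, dist ((s j : ℂ) * hexCenter (root j) - τ j) ℓ₀ < 1 :=
    (tendsto_iff_dist_tendsto_zero.1 hrootlim).eventually (gt_mem_nhds one_pos)
  have hsbd : ∀ᶠ j in atTop, s j < 1 := (tendsto_order.1 hs0).2 1 one_pos
  -- Bolzano–Weierstrass in the product
  set P : ℕ → (Fin N → ℂ) × (Fin N → ℝ) := fun j => (Ck j, ϱk j) with hP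
  set p₀ : (Fin N → ℂ) × (Fin N → ℝ) := (fun _ => ℓ₀, fun _ => 0) with hp₀
  have hPbd : ∀ᶠ j in atTop, P j ∈ closedBall p₀ (2 * |R| + 2) := by
    filter_upwards [hrootbd, hsbd] with j hj hsj
    rw [mem_closedBall, Prod.dist_eq, max_le_iff]
    have hRabs : R ≤ |R| := le_abs_self R
    constructor
    · refine (dist_pi_le_iff (by positivity)).2 fun i => ?_
      calc dist (Ck j i) ℓ₀ ≤ dist (Ck j i) ((s j : ℂ) * hexCenter (root j) - τ j) +
            dist ((s j : ℂ) * hexCenter (root j) - τ j) ℓ₀ := dist_triangle _ _ _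
        _ ≤ 2 * |R| + 2 := by linarith [hCbd j i, abs_nonneg R]
    · refine (dist_pi_le_iff (by positivity)).2 fun i => ?_
      rw [Real.dist_eq, sub_zero, abs_of_nonneg (hϱbd j i).1]
      linarith [(hϱbd j i).2, abs_nonneg R]
  obtain ⟨p, -, ψ, hψ, hlim⟩ := tendsto_subseq_of_frequently_bounded
    (isBounded_closedBall (x := p₀) (r := 2 * |R| + 2)) hPbd.frequently
  -- coordinate limits
  have hClim : ∀ i, Tendsto (fun j => Ck (ψ j) i) atTop (𝓝 (p.1 i)) := fun i =>
    ((continuous_apply i).comp continuous_fst).continuousAt.tendsto.comp hlim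
  have hϱlim : ∀ i, Tendsto (fun j => ϱk (ψ j) i) atTop (𝓝 (p.2 i)) := fun i =>
    ((continuous_apply i).comp continuous_snd).continuousAt.tendsto.comp hlim
  have hsψ : Tendsto (fun j => s (ψ j)) atTop (𝓝 0) := hs0.comp hψ.tendsto_atTop
  have hϱnn : ∀ i, 0 ≤ p.2 i := fun i =>
    ge_of_tendsto' (hϱlim i) fun j => (hϱbd (ψ j) i).1
  have hCR : ∀ i, dist (p.1 i) ℓ₀ ≤ R := by
    intro i
    refine le_of_tendsto' ((continuous_dist.continuousAt.tendsto).comp ((hClim i).prodMk_nhds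
      (hrootlim.comp hψ.tendsto_atTop))) fun j => ?_
    exact hCbd (ψ j) i
  -- the sandwich, per hexagon
  have hsand : ∀ ε > (0 : ℝ), ∀ᶠ j in atTop, ∀ i, dist (Ck (ψ j) i) (p.1 i) < ε / 6 ∧
      |ϱk (ψ j) i - p.2 i| < ε / 6 ∧ s (ψ j) < ε / 6 := by
    intro ε hε
    have h1 : ∀ i, ∀ᶠ j in atTop, dist (Ck (ψ j) i) (p.1 i) < ε / 6 := fun i =>
      (tendsto_iff_dist_tendsto_zero.1 (hClim i)).eventually (gt_mem_nhds (by positivity))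
    have h2 : ∀ i, ∀ᶠ j in atTop, |ϱk (ψ j) i - p.2 i| < ε / 6 := fun i => by
      have := (tendsto_iff_dist_tendsto_zero.1 (hϱlim i)).eventually (gt_mem_nhds (by positivity : (0:ℝ) < ε / 6))
      exact this.mono fun j hj => by rwa [Real.dist_eq] at hj
    have h3 : ∀ᶠ j in atTop, s (ψ j) < ε / 6 := (tendsto_order.1 hsψ).2 _ (by positivity)
    have h12 : ∀ᶠ j in atTop, ∀ i, dist (Ck (ψ j) i) (p.1 i) < ε / 6 ∧ |ϱk (ψ j) i - p.2 i| < ε / 6 := by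
      rw [eventually_all]; exact fun i => (h1 i).and (h2 i)
    filter_upwards [h12, h3] with j hj hsj i
    exact ⟨(hj i).1, (hj i).2, hsj⟩
  -- containment
  have hcont : ∀ ε > (0 : ℝ), ∀ᶠ j in atTop, ∀ (i : Fin N), ∀ v ∈ hexBall (g (ψ j) i).1 (g (ψ j) i).2,
      ∀ ℓ : Fin 3, |skewCoord ℓ ((s (ψ j) : ℂ) * hexCenter v - τ (ψ j) - p.1 i)| ≤ p.2 i + ε := by
    intro ε hε
    filter_upwards [hsand ε hε] with j hj i v hv ℓ
    rw [mem_hexBall_iff_hexCenter_mem_contHex (hspos (ψ j))] at hv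
    have e : (s (ψ j) : ℂ) * hexCenter v = ((s (ψ j) : ℂ) * hexCenter v - τ (ψ j)) + τ (ψ j) := by ring
    rw [e] at hv
    have h0 := abs_le_of_pinned_mem_contHex (hspos (ψ j)) _ _ _ _ hv ℓ
    obtain ⟨hd, hr, hsj⟩ := hj i
    have h1 := abs_skewCoord_sub_le_of_dist ℓ ((s (ψ j) : ℂ) * hexCenter v - τ (ψ j)) (Ck (ψ j) i) (p.1 i)
    rw [abs_lt] at hr
    change |skewCoord ℓ ((s (ψ j) : ℂ) * hexCenter v - τ (ψ j) - Ck (ψ j) i)| ≤ ϱk (ψ j) i + s (ψ j) / 6 at h0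
    linarith
  refine ⟨ψ, fun j => g (ψ j), p.1, p.2, hψ, hϱnn, hCR, fun j v => hgL (ψ j) v, hClim, hϱlim, ?_, hcont, ?_⟩
  · -- persistence
    intro ε hε
    filter_upwards [hsand ε hε] with j hj i v hv
    rw [mem_hexBall_iff_hexCenter_mem_contHex (hspos (ψ j))]
    have e : (s (ψ j) : ℂ) * hexCenter v = ((s (ψ j) : ℂ) * hexCenter v - τ (ψ j)) + τ (ψ j) := by ring
    rw [e]
    refine pinned_mem_contHex_of_abs_le (hspos (ψ j)) _ _ _ _ fun ℓ => ?_
    obtain ⟨hd, hr, hsj⟩ := hj i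
    have h1 := abs_skewCoord_sub_le_of_dist ℓ ((s (ψ j) : ℂ) * hexCenter v - τ (ψ j)) (p.1 i) (Ck (ψ j) i)
    rw [dist_comm] at hd
    have h2 := hv ℓ
    rw [abs_lt] at hr
    show |skewCoord ℓ ((s (ψ j) : ℂ) * hexCenter v - τ (ψ j) - Ck (ψ j) i)| ≤ ϱk (ψ j) i - s (ψ j) / 6
    linarith
  · -- eventual carving of compacts
    intro K hK hdisj
    -- a common positive thickening missing `K`
    have hthick : ∀ i, ∃ ε > (0 : ℝ), Disjoint K {z : ℂ | ∀ ℓ : Fin 3, |skewCoord ℓ (z - p.1 i)| ≤ p.2 i + ε} := by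
      intro i
      have hd := hdisj i
      rw [skewHexAbs_eq] at hd
      obtain ⟨ε, hε, hε'⟩ := exists_pos_disjoint_skewHex_thicken hK hd
      refine ⟨ε, hε, ?_⟩
      rw [skewHexAbs_eq]
      refine Set.disjoint_left.2 fun z hzK hz => Set.disjoint_left.1 hε' hzK fun ℓ => ?_
      obtain ⟨h1, h2⟩ := hz ℓ
      constructor <;> linarith
    choose εi hεi hdisji using hthick
    rcases Nat.eq_zero_or_pos N with hN | hN
    · subst hN
      refine Eventually.of_forall fun j v hv _ => ?_
      obtain ⟨i, -⟩ := (hgL (ψ j) v).1 hv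
      exact i.elim0
    · haveI : Nonempty (Fin N) := ⟨⟨0, hN⟩⟩
      set ε : ℝ := Finset.univ.inf' Finset.univ_nonempty εi with hεdef
      have hε : 0 < ε := by
        rw [hεdef, Finset.lt_inf'_iff]; exact fun i _ => hεi i
      have hεle : ∀ i, ε ≤ εi i := fun i => Finset.inf'_le _ (Finset.mem_univ i)
      filter_upwards [hcont ε hε] with j hj v hv hvK
      obtain ⟨i, hi⟩ := (hgL (ψ j) v).1 hv
      exact Set.disjoint_left.1 (hdisji i) hvK fun ℓ => (hj i v hi ℓ).trans (by linarith [hεle i])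

end Summit.CriticalPhenomena.SAWScalingLimit.Theorems.ObservableToSLE.TypeLadder

end
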